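import Literature.AnabelianGeometry.SemiGraphs.PSCFundamentalGroup
import Literature.AnabelianGeometry.SemiGraphs.SemiGraph
import Mathlib.Topology.Algebra.ContinuousMonoidHom
import Mathlib.Topology.Algebra.Group.Quotient

/-!
# The criterion for graphicity ([CombGC] §1: Prop. 1.2, Def. 1.4 (i)–(iv), Prop. 1.5, Thm. 1.6)

Mochizuki, *A combinatorial version of the Grothendieck conjecture*, Tohoku Math. J. **59** (2007)
[CombGC], §1 "Criterion for Graphicity", author's manuscript pp. 8–14: Proposition 1.2
(Commensurable Terminality), Definition 1.4 (i)–(iv) (graphic; numerically cuspidal; graphically /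
verticially / edge-wise filtration-preserving; group-theoretically cuspidal / edge-like /
verticial — for `α : Π_G ≅ Π_H` and for `β : Π^unr_G ≅ Π^unr_H`), Proposition 1.5 (Incidence
Relations), Theorem 1.6 (Criterion for Graphicity) — items cited by [IUTchI–IV].
[cite: MochizukiCombGC2007, §1 pp.8-14]

## Level of the typing

Everything is typed over the interface `PSCDatum P` of `PSCFundamentalGroup.lean` (Def. 1.1): a
"finite étale `Π_G`-covering `G' → G`" is an open subgroup `H ≤ P`; an isomorphism `α : Π_G ≅ Π_H`
is a `ContinuousMulEquiv`; the covering of `H` "corresponding via `α`" to `H₁ ≤ Π_G` is `α(H₁)`;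
`β : Π^unr_G ≅ Π^unr_H` is an isomorphism of the quotient groups `P ⧸ unrKer`, transported to
subgroups containing the kernels (`unrTransport`); for a `Π^unr_G`-covering `G'` (open `U ⊇ unrKer`)
one has `Π^unr_{G'} = U / unrKer` and `M_{G'}/M^edge_{G'} = (U/unrKer)^ab`, so that "the
isomorphism induced by `β`" is the canonical one.

GEOMETRIC ORIGIN (cell ruling abc-iut-L3-lead 2026-08-25T18:14:50Z).  Definition 1.1 (i) is
EXTRINSIC: `G` "arises as the pro-Σ completion of … the dual semi-graph … of a pointed stable
curve".  Propositions 1.2, 1.5 and Theorem 1.6 are theorems about such `G` and are FALSE for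
arbitrary data satisfying the axioms of `PSCDatum` (take `Π` abelian).  They are therefore typed
twice: (a) as PREDICATES on the data (`G.VerticialEdgeLikeCommensurablyTerminal`, …: "`G`
satisfies the conclusion of Prop. 1.2 (ii)"), and (b) as the printed universally quantified
STATEMENTS `…Holds Ω` over an ORIGIN PREDICATE `Ω.IsOfPSCType G` ("`G` is of pro-Σ PSC-type",
Def. 1.1 (i)) which — pointed stable curves being absent from the tree (FOUNDATIONS rows 13–14) —
is carried as a PARAMETER `Ω : PSCOrigin` (BLACKBOX: never constructed in wave 1; the future
construction of dual semi-graphs of pointed stable curves supplies the intended `Ω₀`, at which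
point every `…Holds Ω₀` is the printed theorem verbatim).  A parameter rather than an `opaque`
constant, so that the statements can later be INSTANTIATED rather than restated.  Nothing is
asserted.  "Commensurably terminal" ([CombGC] §0 p. 3; [SemiAnbd] §0 p. 5) is written out as
`Subgroup.Commensurable.commensurator H = H` (the cell's named predicate for it is
`Literature.AnabelianGeometry.AbsoluteAnabelian.IsCommensurablyTerminal`, seat abc-iut-L4-t4, with
`isCommensurablyTerminal_iff`; not imported here only to keep this file's imports inside the built
tree — ruling abc-iut-L3-lead 2026-08-25T18:25:04Z).  Definition 1.4 (i)
"graphic" (= "arises from an isomorphism of semi-graphs of anabelioids `G ≅ H`") is rendered at the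
interface level by what such an isomorphism determines on the recorded data — an isomorphism of the
underlying semi-graphs compatible via `α` with the verticial / nodal / cuspidal conjugacy classes
(exactly the data from which the proof of Prop. 1.5 (ii), p. 13, rebuilds `G ≅ H`, the anabelioids
being `B(Π_v)`, `B(Π_e)`) -- TODO-merge: abc-iut-L3-t1 (semi-graphs of anabelioids; then prove the
equivalence with the printed Def. 1.4 (i)).  `PSCSemiGraph.toSemiGraph` bridges the finite
vertex/node/cusp presentation of Def. 1.1 (i) to the layer's `SemiGraphs.SemiGraph` ([SemiAnbd] §1,
seat L3-t1).  Definition 1.4 (v), (vi) and Remarks 1.4.2–1.4.4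
(with their [IUTchI] Rmk. 1.2.3 replacements) are in the companion file `PSCRamification.lean`;
Proposition 1.3 (Duality; census row `CombGC:Prop1.3`, not cited by IUT) is NOT typed: its
statement is the perfect pairing on `M_G` induced by the cup product
`H¹(Π_G, Ẑ^Σ) × H¹(Π_G, Ẑ^Σ) → H²(Π_G, Ẑ^Σ) ≅ Ẑ^Σ` with `M^edge_G`, `M^vert_G` mutual annihilators,
and continuous cohomology of profinite groups with `Ẑ^Σ`-coefficients and its cup product are not in
the tree (Mathlib's `groupCohomology` is for discrete groups) -- TODO(general form): Prop. 1.3 once a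
continuous-cohomology interface exists.  Remarks 1.1.x, 1.3.1, 1.4.1, 1.6.1 are expository /
not cited and not typed.  No statement is strengthened; nothing here takes a side on [IUTchIII]
Cor. 3.12.
-/

noncomputable section

namespace Literature.AnabelianGeometry.SemiGraphs

namespace PSCDatum

open scoped Pointwise

universe u

variable {P : Type u} [Group P] [TopologicalSpace P] [IsTopologicalGroup P]
variable {P' : Type u} [Group P'] [TopologicalSpace P'] [IsTopologicalGroup P']

/-! ### The origin predicate "of pro-Σ PSC-type" (Def. 1.1 (i)) as a parameter -/

/-- **[CombGC] Definition 1.1 (i)**, p. 6, as a BLACKBOX parameter: `Ω.IsOfPSCType G` reads "`G`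
[the datum `G : PSCDatum Π`] is of pro-Σ PSC-type", i.e. "arises as the pro-Σ completion [cf.
[SemiAnbd], Definition 2.9, (ii)] of the semi-graph of anabelioids determined by the dual semi-graph
of profinite groups with compact structure … of a pointed stable curve over an algebraically closed
field whose characteristic `∉ Σ`" (with `Σ = G.Sigma`, `Π = Π_G`, and the recorded semi-graph,
verticial / edge-like subgroups and genera those of that curve).  Pointed stable curves and dual
semi-graphs are not in the tree (abc-iut FOUNDATIONS rows 13–14), so the predicate is not defined
here but quantified over: every printed result below is stated as `∀ G, Ω.IsOfPSCType G → …`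
(`…Holds Ω`), to be instantiated at the geometric `Ω₀` once it exists -- TODO-merge: abc-iut-L3-t1
/ the future pointed-stable-curve layer. [cite: MochizukiCombGC2007, Def 1.1(i) p.6] -/
structure _root_.Literature.AnabelianGeometry.SemiGraphs.PSCOrigin : Type (u + 1) where
  /-- "`G` is of pro-Σ PSC-type" (Def. 1.1 (i)) -/
  IsOfPSCType : ∀ {Q : Type u} [Group Q] [TopologicalSpace Q], PSCDatum Q → Prop

/-! ### Bridge to the layer's general semi-graphs ([SemiAnbd] §1 p. 11) -/

/-- The underlying semi-graph of Def. 1.1 (i) as a general semi-graph in the sense of [SemiAnbd]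
§1 p. 11 (`SemiGraphs.SemiGraph`, seat L3-t1): vertices `V`; edges = nodes ⊔ cusps; every edge has
two branches (`(e, false)`, `(e, true)`); both branches of a node abut to the two (possibly equal)
vertices it joins, the first branch of a cusp abuts to its vertex and the second to no vertex
(an open edge).  The bridge asked for by the review of `PSCFundamentalGroup.lean`.
[cite: MochizukiCombGC2007, Def 1.1(i) p.6] -/
noncomputable def _root_.Literature.AnabelianGeometry.SemiGraphs.PSCSemiGraph.toSemiGraph
    (𝔾 : PSCSemiGraph) : SemiGraph.{0} where
  Vertex := 𝔾.V
  Edge := 𝔾.N ⊕ 𝔾.C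
  Branch := (𝔾.N ⊕ 𝔾.C) × Bool
  edgeOf := Prod.fst
  abuts b := match b with
    | (Sum.inl e, false) => some (Quot.out (𝔾.nodeEnds e)).1
    | (Sum.inl e, true) => some (Quot.out (𝔾.nodeEnds e)).2
    | (Sum.inr c, false) => some (𝔾.cuspEnd c)
    | (Sum.inr _, true) => none
  two_branches e := ⟨(e, false), (e, true), by simp, rfl, rfl, fun b hb => by
    obtain ⟨e', bb⟩ := b
    cases hb
    cases bb <;> simp⟩

/-! ### Edges = nodes ⊔ cusps -/

/-- The representative edge-like subgroup of an edge (node or cusp) of `𝔾` (Def. 1.1 (ii), p. 6).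
[cite: MochizukiCombGC2007, Def 1.1(ii) p.6] -/
def edgeGp (G : PSCDatum P) : G.graph.N ⊕ G.graph.C → Subgroup P := Sum.elim G.nodeGp G.cuspGp

/-! ### Proposition 1.2 (Commensurable Terminality), p. 8 — as predicates on `G` -/

/-- **[CombGC] Proposition 1.2 (i)**, p. 8, verticial case: "If `A₁ ∩ A₂` is open in `A₁`, then
`v₁ = v₂`" for verticial subgroups `Aᵢ` arising from vertices `vᵢ`.
[cite: MochizukiCombGC2007, Prop 1.2(i) p.8] -/
def VerticialOpenInterDeterminesVertex (G : PSCDatum P) : Prop :=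
  ∀ (v₁ v₂ : G.graph.V) (γ₁ γ₂ : ConjAct P),
    IsOpen (((γ₁ • G.vertGp v₁ ⊓ γ₂ • G.vertGp v₂).subgroupOf (γ₁ • G.vertGp v₁) :
      Subgroup (γ₁ • G.vertGp v₁ : Subgroup P)) : Set (γ₁ • G.vertGp v₁ : Subgroup P)) → v₁ = v₂

/-- **[CombGC] Proposition 1.2 (i)**, p. 8, edge-like case: "If `A₁ ∩ A₂` is open in `A₁`, then
`e₁ = e₂`" for edge-like subgroups `Aᵢ` arising from edges `eᵢ`.
[cite: MochizukiCombGC2007, Prop 1.2(i) p.8] -/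
def EdgeLikeOpenInterDeterminesEdge (G : PSCDatum P) : Prop :=
  ∀ (e₁ e₂ : G.graph.N ⊕ G.graph.C) (γ₁ γ₂ : ConjAct P),
    IsOpen (((γ₁ • G.edgeGp e₁ ⊓ γ₂ • G.edgeGp e₂).subgroupOf (γ₁ • G.edgeGp e₁) :
      Subgroup (γ₁ • G.edgeGp e₁ : Subgroup P)) : Set (γ₁ • G.edgeGp e₁ : Subgroup P)) → e₁ = e₂

/-- **[CombGC] Proposition 1.2 (i)**, p. 8, unramified case: "under the further assumption that `G`
is sturdy, if `B₁ ∩ B₂` is open in `B₁`, then `v₁ = v₂`", `Bᵢ` the image of `Aᵢ` in `Π^unr_G`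
(recorded as the subgroup `Aᵢ · Ker(Π_G ↠ Π^unr_G)` of `Π_G`).
[cite: MochizukiCombGC2007, Prop 1.2(i) p.8] -/
def UnrVerticialOpenInterDeterminesVertex (G : PSCDatum P) : Prop :=
  G.IsSturdy → ∀ (v₁ v₂ : G.graph.V) (γ₁ γ₂ : ConjAct P),
    IsOpen ((((γ₁ • G.vertGp v₁ ⊔ G.unrKer) ⊓ (γ₂ • G.vertGp v₂ ⊔ G.unrKer)).subgroupOf
      (γ₁ • G.vertGp v₁ ⊔ G.unrKer) : Subgroup (γ₁ • G.vertGp v₁ ⊔ G.unrKer : Subgroup P)) :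
        Set (γ₁ • G.vertGp v₁ ⊔ G.unrKer : Subgroup P)) → v₁ = v₂

/-- **[CombGC] Proposition 1.2 (ii)**, p. 8: "The `Aᵢ` [verticial and edge-like subgroups] are
commensurably terminal in `Π_G`" (`C_Π(A) = A`, §0 p. 3; cf. `AbsoluteAnabelian.IsCommensurablyTerminal`).
[cite: MochizukiCombGC2007, Prop 1.2(ii) p.8] -/
def VerticialEdgeLikeCommensurablyTerminal (G : PSCDatum P) : Prop :=
  ∀ A : Subgroup P, (G.IsVerticial A ∨ G.IsEdgeLike A) → Subgroup.Commensurable.commensurator A = A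

/-- **[CombGC] Proposition 1.2 (ii)**, p. 8, unramified case: "under the further assumption that
`G` is sturdy, the `Bᵢ` are commensurably terminal in `Π^unr_G`" (commensurable terminality of
`A · Ker` in `Π_G`, equivalent to that of its image in `Π^unr_G = Π_G / Ker`).
[cite: MochizukiCombGC2007, Prop 1.2(ii) p.8] -/
def UnrVerticialCommensurablyTerminal (G : PSCDatum P) : Prop :=
  G.IsSturdy → ∀ B : Subgroup P, G.IsUnrVerticial B → Subgroup.Commensurable.commensurator B = B

/-! ### Definition 1.4, pp. 10–11 -/

/-- **[CombGC] Definition 1.4 (i)**, p. 10: `α : Π_G ≅ Π_H` is *graphic* "if it arises from an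
isomorphism of semi-graphs of anabelioids `G ≅ H`".  Interface rendering (see the module
docstring): there is an isomorphism `ι` of the underlying semi-graphs such that `α` carries the
conjugacy class of `Π_v` onto that of `Π_{ι v}`, of `Π_e` onto that of `Π_{ι e}` (nodes), of `Π_c`
onto that of `Π_{ι c}` (cusps). -- TODO-merge: abc-iut-L3-t1.
[cite: MochizukiCombGC2007, Def 1.4(i) p.10] -/
def IsGraphicVia (G : PSCDatum P) (H : PSCDatum P') (α : P ≃ₜ* P')
    (ι : PSCSemiGraph.Iso G.graph H.graph) : Prop :=
  (∀ v : G.graph.V, ∃ γ : ConjAct P',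
      (G.vertGp v).map α.toMulEquiv.toMonoidHom = γ • H.vertGp (ι.vertEquiv v)) ∧
  (∀ e : G.graph.N, ∃ γ : ConjAct P',
      (G.nodeGp e).map α.toMulEquiv.toMonoidHom = γ • H.nodeGp (ι.nodeEquiv e)) ∧
  (∀ c : G.graph.C, ∃ γ : ConjAct P',
      (G.cuspGp c).map α.toMulEquiv.toMonoidHom = γ • H.cuspGp (ι.cuspEquiv c))

/-- **[CombGC] Definition 1.4 (i)**, p. 10: `α` is *graphic* (interface rendering: graphic via some
isomorphism of underlying semi-graphs, `IsGraphicVia`). [cite: MochizukiCombGC2007, Def 1.4(i) p.10] -/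
def IsGraphic (G : PSCDatum P) (H : PSCDatum P') (α : P ≃ₜ* P') : Prop :=
  ∃ ι : PSCSemiGraph.Iso G.graph H.graph, G.IsGraphicVia H α ι

/-- **[CombGC] Definition 1.4 (ii)**, p. 10: `α` is *numerically cuspidal* "if, for any pair of
finite étale coverings `G' → G`, `H' → H` which correspond via `α`, we have `r(G') = r(H')`".
[cite: MochizukiCombGC2007, Def 1.4(ii) p.10] -/
def IsNumericallyCuspidal (G : PSCDatum P) (H : PSCDatum P') (α : P ≃ₜ* P') : Prop :=
  ∀ U : Subgroup P, IsOpen (U : Set P) → G.cuspCount U = H.cuspCount (U.map α.toMulEquiv.toMonoidHom)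

/-- **[CombGC] Definition 1.4 (iii)**, p. 10: `α` is *verticially filtration-preserving* if for
corresponding coverings the isomorphism `M_{G'} ≅ M_{H'}` induced by `α` "induces an isomorphism
between the respective verticial submodules". [cite: MochizukiCombGC2007, Def 1.4(iii) p.10] -/
def IsVerticiallyFiltrationPreserving (G : PSCDatum P) (H : PSCDatum P') (α : P ≃ₜ* P') : Prop :=
  ∀ U : Subgroup P, IsOpen (U : Set P) →
    (G.vertFil U).map α.toMulEquiv.toMonoidHom = H.vertFil (U.map α.toMulEquiv.toMonoidHom)

/-- **[CombGC] Definition 1.4 (iii)**, p. 10: `α` is *edge-wise filtration-preserving* (same with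
the edge-like submodules). [cite: MochizukiCombGC2007, Def 1.4(iii) p.10] -/
def IsEdgewiseFiltrationPreserving (G : PSCDatum P) (H : PSCDatum P') (α : P ≃ₜ* P') : Prop :=
  ∀ U : Subgroup P, IsOpen (U : Set P) →
    (G.edgeFil U).map α.toMulEquiv.toMonoidHom = H.edgeFil (U.map α.toMulEquiv.toMonoidHom)

/-- **[CombGC] Definition 1.4 (iii)**, p. 10: `α` is *graphically filtration-preserving* (it
"induces an isomorphism between the respective verticial and edge-like submodules").
[cite: MochizukiCombGC2007, Def 1.4(iii) p.10] -/
def IsGraphicallyFiltrationPreserving (G : PSCDatum P) (H : PSCDatum P') (α : P ≃ₜ* P') : Prop :=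
  G.IsVerticiallyFiltrationPreserving H α ∧ G.IsEdgewiseFiltrationPreserving H α

/-- **[CombGC] Definition 1.4 (iv)**, p. 11: `α` is *group-theoretically cuspidal* if "it maps each
cuspidal subgroup of `Π_G` isomorphically onto a cuspidal subgroup of `Π_H`, and, moreover, every
cuspidal subgroup of `Π_H` arises in this fashion". [cite: MochizukiCombGC2007, Def 1.4(iv) p.11] -/
def IsGroupTheoreticallyCuspidal (G : PSCDatum P) (H : PSCDatum P') (α : P ≃ₜ* P') : Prop :=
  (∀ A, G.IsCuspidal A → H.IsCuspidal (A.map α.toMulEquiv.toMonoidHom)) ∧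
    ∀ B, H.IsCuspidal B → ∃ A, G.IsCuspidal A ∧ A.map α.toMulEquiv.toMonoidHom = B

/-- **[CombGC] Definition 1.4 (iv)**, p. 11: `α` is *group-theoretically edge-like*.
[cite: MochizukiCombGC2007, Def 1.4(iv) p.11] -/
def IsGroupTheoreticallyEdgeLike (G : PSCDatum P) (H : PSCDatum P') (α : P ≃ₜ* P') : Prop :=
  (∀ A, G.IsEdgeLike A → H.IsEdgeLike (A.map α.toMulEquiv.toMonoidHom)) ∧
    ∀ B, H.IsEdgeLike B → ∃ A, G.IsEdgeLike A ∧ A.map α.toMulEquiv.toMonoidHom = B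

/-- **[CombGC] Definition 1.4 (iv)**, p. 11: `α` is *group-theoretically verticial*.
[cite: MochizukiCombGC2007, Def 1.4(iv) p.11] -/
def IsGroupTheoreticallyVerticial (G : PSCDatum P) (H : PSCDatum P') (α : P ≃ₜ* P') : Prop :=
  (∀ A, G.IsVerticial A → H.IsVerticial (A.map α.toMulEquiv.toMonoidHom)) ∧
    ∀ B, H.IsVerticial B → ∃ A, G.IsVerticial A ∧ A.map α.toMulEquiv.toMonoidHom = B

section Unr

/-- `Ker(Π_G ↠ Π^unr_G)` is normal. [cite: MochizukiCombGC2007, Def 1.1(ii) p.7] -/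
instance unrKer_normal (G : PSCDatum P) : G.unrKer.Normal :=
  Subgroup.is_normal_topologicalClosure _

/-- Transport of a subgroup `S ⊇ Ker` of `Π_G` along `β : Π^unr_G ≅ Π^unr_H` (quotients by
`unrKer`) to the subgroup `⊇ Ker` of `Π_H` with the corresponding image.
[cite: MochizukiCombGC2007, Def 1.4 p.10] -/
def unrTransport (G : PSCDatum P) (H : PSCDatum P') (β : (P ⧸ G.unrKer) ≃ₜ* (P' ⧸ H.unrKer))
    (S : Subgroup P) : Subgroup P' :=
  ((S.map (QuotientGroup.mk' G.unrKer)).map β.toMulEquiv.toMonoidHom).comap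
    (QuotientGroup.mk' H.unrKer)

/-- **[CombGC] Definition 1.4 (iii)**, p. 10, for `β : Π^unr_G ≅ Π^unr_H`: `β` is *verticially
filtration-preserving* if for corresponding `Π^unr`-coverings `G'`, `H'` the isomorphism
`M_{G'}/M^edge_{G'} ≅ M_{H'}/M^edge_{H'}` induced by `β` induces `M^vert_{G'}/M^edge_{G'} ≅
M^vert_{H'}/M^edge_{H'}` (both filtration subgroups contain `Ker(Π_G ↠ Π^unr_G)`).
[cite: MochizukiCombGC2007, Def 1.4(iii) p.10] -/
def IsUnrVerticiallyFiltrationPreserving (G : PSCDatum P) (H : PSCDatum P')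
    (β : (P ⧸ G.unrKer) ≃ₜ* (P' ⧸ H.unrKer)) : Prop :=
  ∀ U : Subgroup P, IsOpen (U : Set P) → G.unrKer ≤ U →
    G.unrTransport H β (G.vertFil U) = H.vertFil (G.unrTransport H β U)

/-- **[CombGC] Definition 1.4 (iv)**, p. 11, for `β`: `β` is *group-theoretically verticial* if "it
maps each unramified verticial subgroup of `Π^unr_G` isomorphically onto an unramified verticial
subgroup of `Π^unr_H`, and, moreover, every verticial subgroup of `Π^unr_H` arises in this
fashion". [cite: MochizukiCombGC2007, Def 1.4(iv) p.11] -/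
def IsUnrGroupTheoreticallyVerticial (G : PSCDatum P) (H : PSCDatum P')
    (β : (P ⧸ G.unrKer) ≃ₜ* (P' ⧸ H.unrKer)) : Prop :=
  (∀ B, G.IsUnrVerticial B → H.IsUnrVerticial (G.unrTransport H β B)) ∧
    ∀ B', H.IsUnrVerticial B' → ∃ B, G.IsUnrVerticial B ∧ G.unrTransport H β B = B'

end Unr

/-! ### Proposition 1.5 (Incidence Relations), pp. 12–13 — as predicates -/

/-- **[CombGC] Proposition 1.5 (i)**, p. 12: "An edge-like subgroup of `Π_G` is cuspidal
(respectively, not cuspidal) if and only if it is contained in precisely one (respectively,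
precisely two) verticial subgroup(s)." [cite: MochizukiCombGC2007, Prop 1.5(i) p.12] -/
def EdgeLikeIncidence (G : PSCDatum P) : Prop :=
  ∀ E : Subgroup P, G.IsEdgeLike E →
    (G.IsCuspidal E ↔ ∃! A : Subgroup P, G.IsVerticial A ∧ E ≤ A) ∧
    (¬ G.IsCuspidal E ↔ ∃ A₁ A₂ : Subgroup P, A₁ ≠ A₂ ∧
      ∀ A : Subgroup P, (G.IsVerticial A ∧ E ≤ A) ↔ (A = A₁ ∨ A = A₂))

/-- **[CombGC] Proposition 1.5 (ii)**, p. 13: "`α` is graphic if and only if it is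
group-theoretically edge-like and group-theoretically verticial. Moreover, in this case, `α` arises
from a unique isomorphism of semi-graphs of anabelioids `G ≅ H`" (uniqueness recorded on the
underlying semi-graphs). [cite: MochizukiCombGC2007, Prop 1.5(ii) p.13] -/
def GraphicIffEdgeLikeVerticial (G : PSCDatum P) (H : PSCDatum P') (α : P ≃ₜ* P') : Prop :=
  (G.IsGraphic H α ↔ G.IsGroupTheoreticallyEdgeLike H α ∧ G.IsGroupTheoreticallyVerticial H α) ∧
    ∀ ι ι' : PSCSemiGraph.Iso G.graph H.graph, G.IsGraphicVia H α ι → G.IsGraphicVia H α ι' →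
      ι.vertEquiv = ι'.vertEquiv ∧ ι.nodeEquiv = ι'.nodeEquiv ∧ ι.cuspEquiv = ι'.cuspEquiv

/-! ### Theorem 1.6 (Criterion for Graphicity), p. 13 — as predicates -/

/-- **[CombGC] Theorem 1.6 (i)**, p. 13: "`α` is numerically cuspidal if and only if it is
group-theoretically cuspidal." [cite: MochizukiCombGC2007, Thm 1.6(i) p.13] -/
def NumericallyCuspidalIffGroupTheoreticallyCuspidal (G : PSCDatum P) (H : PSCDatum P')
    (α : P ≃ₜ* P') : Prop :=
  G.IsNumericallyCuspidal H α ↔ G.IsGroupTheoreticallyCuspidal H α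

/-- **[CombGC] Theorem 1.6 (ii)**, p. 13: "`α` is graphic if and only if it is graphically
filtration-preserving." [cite: MochizukiCombGC2007, Thm 1.6(ii) p.13] -/
def GraphicIffGraphicallyFiltrationPreserving (G : PSCDatum P) (H : PSCDatum P')
    (α : P ≃ₜ* P') : Prop :=
  G.IsGraphic H α ↔ G.IsGraphicallyFiltrationPreserving H α

/-- **[CombGC] Theorem 1.6 (iii)**, p. 13: "Assume that `G`, `H` are sturdy. Then `β` is
verticially filtration-preserving if and only if it is group-theoretically verticial."
[cite: MochizukiCombGC2007, Thm 1.6(iii) p.13] -/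
def UnrVerticiallyFiltrationPreservingIffVerticial (G : PSCDatum P) (H : PSCDatum P')
    (β : (P ⧸ G.unrKer) ≃ₜ* (P' ⧸ H.unrKer)) : Prop :=
  G.IsSturdy → H.IsSturdy →
    (G.IsUnrVerticiallyFiltrationPreserving H β ↔ G.IsUnrGroupTheoreticallyVerticial H β)

/-! ### The printed statements over the origin predicate (`…Holds Ω`) -/

section Statements

variable (Ω : PSCOrigin.{u})

/-- **[CombGC] Proposition 1.2 (i)** (p. 8) as printed: for every `G` of PSC-type, the verticial,
edge-like and (for `G` sturdy) unramified-verticial cases. [cite: MochizukiCombGC2007, Prop 1.2(i) p.8] -/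
def OpenInterDeterminesComponentHolds : Prop :=
  ∀ ⦃Q : Type u⦄ [Group Q] [TopologicalSpace Q] [IsTopologicalGroup Q] (G : PSCDatum Q),
    Ω.IsOfPSCType G → G.VerticialOpenInterDeterminesVertex ∧ G.EdgeLikeOpenInterDeterminesEdge ∧
      G.UnrVerticialOpenInterDeterminesVertex

/-- **[CombGC] Proposition 1.2 (ii)** (p. 8) as printed: for every `G` of PSC-type, verticial and
edge-like subgroups are commensurably terminal in `Π_G`, and (for `G` sturdy) unramified verticial
subgroups in `Π^unr_G`. [cite: MochizukiCombGC2007, Prop 1.2(ii) p.8] -/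
def CommensurableTerminalityHolds : Prop :=
  ∀ ⦃Q : Type u⦄ [Group Q] [TopologicalSpace Q] [IsTopologicalGroup Q] (G : PSCDatum Q),
    Ω.IsOfPSCType G → G.VerticialEdgeLikeCommensurablyTerminal ∧ G.UnrVerticialCommensurablyTerminal

/-- **[CombGC] Proposition 1.5 (i)** (p. 12) as printed, for every `G` of PSC-type.
[cite: MochizukiCombGC2007, Prop 1.5(i) p.12] -/
def EdgeLikeIncidenceHolds : Prop :=
  ∀ ⦃Q : Type u⦄ [Group Q] [TopologicalSpace Q] (G : PSCDatum Q), Ω.IsOfPSCType G →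
    G.EdgeLikeIncidence

/-- **[CombGC] Proposition 1.5 (ii)** (p. 13) as printed, for all `G`, `H` of PSC-type and every
isomorphism `α : Π_G ≅ Π_H`. [cite: MochizukiCombGC2007, Prop 1.5(ii) p.13] -/
def GraphicIffEdgeLikeVerticialHolds : Prop :=
  ∀ ⦃Q : Type u⦄ [Group Q] [TopologicalSpace Q] [IsTopologicalGroup Q]
    ⦃Q' : Type u⦄ [Group Q'] [TopologicalSpace Q'] [IsTopologicalGroup Q']
    (G : PSCDatum Q) (H : PSCDatum Q') (α : Q ≃ₜ* Q'),
    Ω.IsOfPSCType G → Ω.IsOfPSCType H → G.GraphicIffEdgeLikeVerticial H α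

/-- **[CombGC] Theorem 1.6 (i)** (p. 13) as printed: for all `G`, `H` of PSC-type and every
`α : Π_G ≅ Π_H`, "`α` is numerically cuspidal if and only if it is group-theoretically cuspidal".
[cite: MochizukiCombGC2007, Thm 1.6(i) p.13] -/
def NumericallyCuspidalIffHolds : Prop :=
  ∀ ⦃Q : Type u⦄ [Group Q] [TopologicalSpace Q] [IsTopologicalGroup Q]
    ⦃Q' : Type u⦄ [Group Q'] [TopologicalSpace Q'] [IsTopologicalGroup Q']
    (G : PSCDatum Q) (H : PSCDatum Q') (α : Q ≃ₜ* Q'),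
    Ω.IsOfPSCType G → Ω.IsOfPSCType H → G.NumericallyCuspidalIffGroupTheoreticallyCuspidal H α

/-- **[CombGC] Theorem 1.6 (ii)** (p. 13) as printed: "`α` is graphic if and only if it is
graphically filtration-preserving". [cite: MochizukiCombGC2007, Thm 1.6(ii) p.13] -/
def GraphicIffFiltrationPreservingHolds : Prop :=
  ∀ ⦃Q : Type u⦄ [Group Q] [TopologicalSpace Q] [IsTopologicalGroup Q]
    ⦃Q' : Type u⦄ [Group Q'] [TopologicalSpace Q'] [IsTopologicalGroup Q']
    (G : PSCDatum Q) (H : PSCDatum Q') (α : Q ≃ₜ* Q'),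
    Ω.IsOfPSCType G → Ω.IsOfPSCType H → G.GraphicIffGraphicallyFiltrationPreserving H α

/-- **[CombGC] Theorem 1.6 (iii)** (p. 13) as printed: for `G`, `H` sturdy of PSC-type and every
`β : Π^unr_G ≅ Π^unr_H`, "`β` is verticially filtration-preserving if and only if it is
group-theoretically verticial". [cite: MochizukiCombGC2007, Thm 1.6(iii) p.13] -/
def UnrVerticialIffHolds : Prop :=
  ∀ ⦃Q : Type u⦄ [Group Q] [TopologicalSpace Q] [IsTopologicalGroup Q]
    ⦃Q' : Type u⦄ [Group Q'] [TopologicalSpace Q'] [IsTopologicalGroup Q']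
    (G : PSCDatum Q) (H : PSCDatum Q') (β : (Q ⧸ G.unrKer) ≃ₜ* (Q' ⧸ H.unrKer)),
    Ω.IsOfPSCType G → Ω.IsOfPSCType H → G.UnrVerticiallyFiltrationPreservingIffVerticial H β

end Statements

end PSCDatum

end Literature.AnabelianGeometry.SemiGraphs

end
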